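import Mathlib.Analysis.Convex.Deriv
import Mathlib.Analysis.SpecialFunctions.Log.Deriv
import Mathlib.Analysis.SpecialFunctions.ExpDeriv
import Mathlib.Analysis.SpecialFunctions.Pow.Real
import Summits.CriticalPhenomena.PercolationContinuityZ3.Theorems.PercNearOneGluingNoHeavyLowerTailThreePointIsoSexticOnePair
import HarnessLib

/-!
# Asymmetric isolation laws along ONE pair weight: convexity of `Q^{p+q}/(I_a^p I_b^q)` under the decrement condition

Support file for crux `stmt-CriticalPhenomena-4575` (`NoHeavyLowerTail`), seat `prim-l12-p1` gen 34 (`--supports stmt-CriticalPhenomena-4575`);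
memo `run/shared/lean/prim/prim-l12/FROM-prim-l12-p1-g34-LV-CONE-ASYM-ISOLATION.md`.  No definitions, no sorries, standard axioms.

This is the real-analysis shell of the ONE-PARAMETER FAMILY of isolation laws generalising the sextic law `(Q6)`
(`…ThreePointIsoSexticOnePair`, exponents `(3; 3/2, 3/2)`): for reals `p, q ≥ 1` with

  `p² + pq + q² ≤ pq(p+q)`        (boundary curve through `p = q = 3/2`; parametrisation `p = (1+σ+σ²)/(σ(1+σ))`, `q = σp`)

and every finite weighted graph with terminals `a, b` and port `c`:  `Q^{p+q} ≤ I_a^p · I_b^q · I_c`, where `Q = μ(a|b|c)`,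
`I_a = μ(a ↮ {b,c})`, `I_b = μ(b ↮ {a,c})`, `I_c = μ(c ↮ {a,b})` (graph assembly in `…ThreePointIsoAsymUniversal`).
Along the weight `r` of one pair at the port the four coordinates are affine, `Q(r) = q₀ − r·dq`, `I_a(r) = a₀ − r·da`,
`I_b(r) = b₀ − r·db`, and with `X = dq/Q(r)`, `A = da/I_a(r)`, `B = db/I_b(r)`, `D = X − A − B`,
`ψ = (p+q) log Q − p log I_a − q log I_b` satisfies the KEY IDENTITY

  `ψ'' + ψ'² = (p+q)(p+q−1)·D² + 2(p+q)·[(q−1)A + (p−1)B]·D + [q(q−1)A² + 2(pq−p−q)AB + p(p−1)B²]`,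

whose last quadratic form is positive semidefinite exactly when `p² + pq + q² ≤ pq(p+q)`.  Hence under the decrement condition `XS`
(`D ≥ 0`, a consequence of van den Berg–Häggström–Kahn as in the sextic files) `exp ψ` is convex, and the chord under the affine `I_c`
gives the law along the whole pencil (`asym_onePair_log`, endpoint form without positivity hypotheses, in logarithmic form).
-/

namespace Summit.CriticalPhenomena.PercolationContinuityZ3.Theorems.ThreePointIsoAsymOnePair

open Set Real
open Summit.CriticalPhenomena.PercolationContinuityZ3.Theorems.ThreePointIsoSexticOnePair

/-! ## Calculus along the weight of one pair -/

/-- Derivative of `ψ(r) = P log(q₀ − r·dq) − p log(a₀ − r·da) − q log(b₀ − r·db)`. [this work] -/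
theorem hasDerivAt_psi {P p q q₀ dq a₀ da b₀ db r : ℝ} (h1 : q₀ - r * dq ≠ 0) (h2 : a₀ - r * da ≠ 0) (h3 : b₀ - r * db ≠ 0) :
    HasDerivAt (fun r => P * log (q₀ - r * dq) - p * log (a₀ - r * da) - q * log (b₀ - r * db))
      (P * (-dq / (q₀ - r * dq)) - p * (-da / (a₀ - r * da)) - q * (-db / (b₀ - r * db))) r := by
  have e1 : HasDerivAt (fun r => q₀ - r * dq) (-dq) r := (hasDerivAt_mul_const dq).const_sub q₀
  have e2 : HasDerivAt (fun r => a₀ - r * da) (-da) r := (hasDerivAt_mul_const da).const_sub a₀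
  have e3 : HasDerivAt (fun r => b₀ - r * db) (-db) r := (hasDerivAt_mul_const db).const_sub b₀
  exact (((e1.log h1).const_mul P).fun_sub ((e2.log h2).const_mul p)).fun_sub ((e3.log h3).const_mul q)

/-- Derivative of `ψ'`. [this work] -/
theorem hasDerivAt_psi1 {P p q q₀ dq a₀ da b₀ db r : ℝ} (h1 : q₀ - r * dq ≠ 0) (h2 : a₀ - r * da ≠ 0) (h3 : b₀ - r * db ≠ 0) :
    HasDerivAt (fun r => P * (-dq / (q₀ - r * dq)) - p * (-da / (a₀ - r * da)) - q * (-db / (b₀ - r * db)))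
      (P * (-dq ^ 2 / (q₀ - r * dq) ^ 2) - p * (-da ^ 2 / (a₀ - r * da) ^ 2)
        - q * (-db ^ 2 / (b₀ - r * db) ^ 2)) r := by
  -- the sextic file's computation with coefficients `(3, 3/2, 3/2)` replaced by `(P, p, q)`
  have key : ∀ {x0 dx : ℝ}, x0 - r * dx ≠ 0 →
      HasDerivAt (fun r => -dx / (x0 - r * dx)) (-dx ^ 2 / (x0 - r * dx) ^ 2) r := by
    intro x0 dx h
    have h0 := (hasDerivAt_const r (-dx)).fun_div ((hasDerivAt_mul_const dx).const_sub x0) h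
    simp only [zero_mul, zero_sub] at h0
    refine h0.congr_deriv ?_
    ring
  exact (((key h1).const_mul P).fun_sub ((key h2).const_mul p)).fun_sub ((key h3).const_mul q)

/-- The admissibility condition `p² + pq + q² ≤ pq(p+q)` with `p, q ≥ 1` forces `p > 1` and `q > 1`. [this work] -/
theorem one_lt_of_admissible {p q : ℝ} (hp : 1 ≤ p) (hq : 1 ≤ q) (hpq : p ^ 2 + p * q + q ^ 2 ≤ p * q * (p + q)) :
    1 < p ∧ 1 < q := by
  constructor
  · by_contra h
    have hp1 : p = 1 := le_antisymm (not_lt.1 h) hp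
    subst hp1
    nlinarith
  · by_contra h
    have hq1 : q = 1 := le_antisymm (not_lt.1 h) hq
    subst hq1
    nlinarith

/-- The quadratic form of the key identity is positive semidefinite on the admissible exponents:
`q(q−1)A² + 2(pq−p−q)AB + p(p−1)B² ≥ 0` for all real `A, B` when `p, q ≥ 1`, `p² + pq + q² ≤ pq(p+q)`. [this work] -/
theorem quadForm_nonneg {p q A B : ℝ} (hp : 1 ≤ p) (hq : 1 ≤ q) (hpq : p ^ 2 + p * q + q ^ 2 ≤ p * q * (p + q)) :
    0 ≤ q * (q - 1) * A ^ 2 + 2 * (p * q - p - q) * (A * B) + p * (p - 1) * B ^ 2 := by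
  obtain ⟨hp1, hq1⟩ := one_lt_of_admissible hp hq hpq
  have hqq : 0 < q * (q - 1) := mul_pos (by linarith) (by linarith)
  -- `q(q−1) · form = (q(q−1)A + (pq−p−q)B)² + (pq(p+q) − (p²+pq+q²)) B²`
  have hdisc : 0 ≤ (p * q * (p + q) - (p ^ 2 + p * q + q ^ 2)) * B ^ 2 := mul_nonneg (by linarith) (sq_nonneg B)
  have key : q * (q - 1) * (q * (q - 1) * A ^ 2 + 2 * (p * q - p - q) * (A * B) + p * (p - 1) * B ^ 2) =
      (q * (q - 1) * A + (p * q - p - q) * B) ^ 2 + (p * q * (p + q) - (p ^ 2 + p * q + q ^ 2)) * B ^ 2 := by ring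
  have h := add_nonneg (sq_nonneg (q * (q - 1) * A + (p * q - p - q) * B)) hdisc
  rw [← key] at h
  rw [← not_lt]
  intro hneg
  have := mul_neg_of_pos_of_neg hqq hneg
  linarith

/-- **The key identity and sign.**  With `X = dq/Q`, `A = da/I_a`, `B = db/I_b`, `D = X − A − B`:
`ψ'' + ψ'² = (p+q)(p+q−1)D² + 2(p+q)[(q−1)A + (p−1)B]D + [q(q−1)A² + 2(pq−p−q)AB + p(p−1)B²]`, hence `≥ 0` under the
decrement condition `XS : dq·I_a·I_b ≥ Q·(da·I_b + db·I_a)` (`D ≥ 0`), `da, db ≥ 0`, and admissible `p, q`. [this work] -/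
theorem asym_key {p q q₀ dq a₀ da b₀ db r : ℝ} (hp : 1 ≤ p) (hq : 1 ≤ q) (hpq : p ^ 2 + p * q + q ^ 2 ≤ p * q * (p + q))
    (hQ : 0 < q₀ - r * dq) (hA : 0 < a₀ - r * da) (hB : 0 < b₀ - r * db) (hda : 0 ≤ da) (hdb : 0 ≤ db)
    (hXS : (q₀ - r * dq) * (da * (b₀ - r * db) + db * (a₀ - r * da)) ≤ dq * (a₀ - r * da) * (b₀ - r * db)) :
    0 ≤ ((p + q) * (-dq / (q₀ - r * dq)) - p * (-da / (a₀ - r * da)) - q * (-db / (b₀ - r * db))) ^ 2 +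
      ((p + q) * (-dq ^ 2 / (q₀ - r * dq) ^ 2) - p * (-da ^ 2 / (a₀ - r * da) ^ 2)
        - q * (-db ^ 2 / (b₀ - r * db) ^ 2)) := by
  set X : ℝ := dq / (q₀ - r * dq) with hX
  set A : ℝ := da / (a₀ - r * da) with hAdef
  set B : ℝ := db / (b₀ - r * db) with hBdef
  have eX : -dq / (q₀ - r * dq) = -X := by rw [hX, neg_div]
  have eA : -da / (a₀ - r * da) = -A := by rw [hAdef, neg_div]
  have eB : -db / (b₀ - r * db) = -B := by rw [hBdef, neg_div]
  have eX2 : -dq ^ 2 / (q₀ - r * dq) ^ 2 = -X ^ 2 := by rw [hX, neg_div, div_pow]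
  have eA2 : -da ^ 2 / (a₀ - r * da) ^ 2 = -A ^ 2 := by rw [hAdef, neg_div, div_pow]
  have eB2 : -db ^ 2 / (b₀ - r * db) ^ 2 = -B ^ 2 := by rw [hBdef, neg_div, div_pow]
  rw [eX, eA, eB, eX2, eA2, eB2]
  have hA0 : 0 ≤ A := div_nonneg hda hA.le
  have hB0 : 0 ≤ B := div_nonneg hdb hB.le
  -- `A + B ≤ X` from `XS`
  have hS : A + B ≤ X := by
    rw [hX, hAdef, hBdef, div_add_div _ _ hA.ne' hB.ne', div_le_div_iff₀ (mul_pos hA hB) hQ]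
    calc (da * (b₀ - r * db) + (a₀ - r * da) * db) * (q₀ - r * dq)
        = (q₀ - r * dq) * (da * (b₀ - r * db) + db * (a₀ - r * da)) := by ring
      _ ≤ dq * (a₀ - r * da) * (b₀ - r * db) := hXS
      _ = dq * ((a₀ - r * da) * (b₀ - r * db)) := by ring
  have hD : 0 ≤ X - A - B := by linarith
  have key : ((p + q) * -X - p * -A - q * -B) ^ 2 + ((p + q) * -X ^ 2 - p * -A ^ 2 - q * -B ^ 2) =
      (p + q) * (p + q - 1) * (X - A - B) ^ 2 + 2 * (p + q) * ((q - 1) * A + (p - 1) * B) * (X - A - B) +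
        (q * (q - 1) * A ^ 2 + 2 * (p * q - p - q) * (A * B) + p * (p - 1) * B ^ 2) := by ring
  rw [key]
  have h1 : 0 ≤ (p + q) * (p + q - 1) * (X - A - B) ^ 2 :=
    mul_nonneg (mul_nonneg (by linarith) (by linarith)) (sq_nonneg _)
  have h2 : 0 ≤ 2 * (p + q) * ((q - 1) * A + (p - 1) * B) * (X - A - B) :=
    mul_nonneg (mul_nonneg (by linarith) (add_nonneg (mul_nonneg (by linarith) hA0) (mul_nonneg (by linarith) hB0))) hD
  have h3 := quadForm_nonneg (A := A) (B := B) hp hq hpq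
  linarith

/-- **Convexity of `Φ(r) = Q(r)^{p+q}/(I_a(r)^p I_b(r)^q)` on `[0,1]` under the decrement condition `XS`** (written `Φ = exp ∘ ψ`).
Hypotheses: the three affine functions are positive at both ends, `da, db ≥ 0`, `XS` at every `r ∈ [0,1]`, admissible `p, q`. [this work] -/
theorem convexOn_asym {p q q₀ dq a₀ da b₀ db : ℝ} (hp : 1 ≤ p) (hq : 1 ≤ q) (hpq : p ^ 2 + p * q + q ^ 2 ≤ p * q * (p + q))
    (hq0 : 0 < q₀) (hq1 : 0 < q₀ - dq) (ha0 : 0 < a₀) (ha1 : 0 < a₀ - da)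
    (hb0 : 0 < b₀) (hb1 : 0 < b₀ - db) (hda : 0 ≤ da) (hdb : 0 ≤ db)
    (hXS : ∀ r ∈ Icc (0 : ℝ) 1, (q₀ - r * dq) * (da * (b₀ - r * db) + db * (a₀ - r * da)) ≤ dq * (a₀ - r * da) * (b₀ - r * db)) :
    ConvexOn ℝ (Icc (0 : ℝ) 1)
      (fun r => exp ((p + q) * log (q₀ - r * dq) - p * log (a₀ - r * da) - q * log (b₀ - r * db))) := by
  have pos : ∀ r ∈ Icc (0 : ℝ) 1, 0 < q₀ - r * dq ∧ 0 < a₀ - r * da ∧ 0 < b₀ - r * db := by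
    intro r hr
    obtain ⟨hr0, hr1⟩ := hr
    have affine_pos : ∀ {x0 x1 : ℝ}, 0 < x0 → 0 < x1 → 0 < (1 - r) * x0 + r * x1 := by
      intro x0 x1 h0 h1
      rcases le_or_gt r (1 / 2) with h | h
      · have : 0 ≤ r * x1 := mul_nonneg hr0 h1.le
        nlinarith
      · have : 0 ≤ (1 - r) * x0 := mul_nonneg (sub_nonneg.2 hr1) h0.le
        nlinarith
    refine ⟨?_, ?_, ?_⟩
    · have : q₀ - r * dq = (1 - r) * q₀ + r * (q₀ - dq) := by ring
      rw [this]; exact affine_pos hq0 hq1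
    · have : a₀ - r * da = (1 - r) * a₀ + r * (a₀ - da) := by ring
      rw [this]; exact affine_pos ha0 ha1
    · have : b₀ - r * db = (1 - r) * b₀ + r * (b₀ - db) := by ring
      rw [this]; exact affine_pos hb0 hb1
  refine convexOn_of_hasDerivWithinAt2_nonneg (convex_Icc 0 1)
    (f' := fun r => exp ((p + q) * log (q₀ - r * dq) - p * log (a₀ - r * da) - q * log (b₀ - r * db)) *
      ((p + q) * (-dq / (q₀ - r * dq)) - p * (-da / (a₀ - r * da)) - q * (-db / (b₀ - r * db))))
    (f'' := fun r => exp ((p + q) * log (q₀ - r * dq) - p * log (a₀ - r * da) - q * log (b₀ - r * db)) *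
      ((p + q) * (-dq / (q₀ - r * dq)) - p * (-da / (a₀ - r * da)) - q * (-db / (b₀ - r * db))) *
      ((p + q) * (-dq / (q₀ - r * dq)) - p * (-da / (a₀ - r * da)) - q * (-db / (b₀ - r * db))) +
      exp ((p + q) * log (q₀ - r * dq) - p * log (a₀ - r * da) - q * log (b₀ - r * db)) *
      ((p + q) * (-dq ^ 2 / (q₀ - r * dq) ^ 2) - p * (-da ^ 2 / (a₀ - r * da) ^ 2)
        - q * (-db ^ 2 / (b₀ - r * db) ^ 2)))
    ?_ ?_ ?_ ?_
  · intro r hr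
    obtain ⟨h1, h2, h3⟩ := pos r hr
    exact ((hasDerivAt_psi (P := p + q) h1.ne' h2.ne' h3.ne').exp).continuousAt.continuousWithinAt
  · intro r hr
    rw [interior_Icc] at hr
    obtain ⟨h1, h2, h3⟩ := pos r (Ioo_subset_Icc_self hr)
    exact ((hasDerivAt_psi (P := p + q) h1.ne' h2.ne' h3.ne').exp).hasDerivWithinAt
  · intro r hr
    rw [interior_Icc] at hr
    obtain ⟨h1, h2, h3⟩ := pos r (Ioo_subset_Icc_self hr)
    exact (((hasDerivAt_psi (P := p + q) h1.ne' h2.ne' h3.ne').exp).fun_mul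
      (hasDerivAt_psi1 (P := p + q) h1.ne' h2.ne' h3.ne')).hasDerivWithinAt
  · intro r hr
    rw [interior_Icc] at hr
    have hr' := Ioo_subset_Icc_self hr
    obtain ⟨h1, h2, h3⟩ := pos r hr'
    have hk := asym_key hp hq hpq h1 h2 h3 hda hdb (hXS r hr')
    set E := exp ((p + q) * log (q₀ - r * dq) - p * log (a₀ - r * da) - q * log (b₀ - r * db)) with hEdef
    set F1 := (p + q) * (-dq / (q₀ - r * dq)) - p * (-da / (a₀ - r * da)) - q * (-db / (b₀ - r * db)) with hF1
    set F2 := (p + q) * (-dq ^ 2 / (q₀ - r * dq) ^ 2) - p * (-da ^ 2 / (a₀ - r * da) ^ 2)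
        - q * (-db ^ 2 / (b₀ - r * db) ^ 2) with hF2
    have hE : 0 ≤ E := (exp_pos _).le
    have e : E * F1 * F1 + E * F2 = E * (F1 ^ 2 + F2) := by ring
    rw [e]
    exact mul_nonneg hE hk

/-- From the logarithmic law `P log Q ≤ p log I_a + q log I_b + log C` (all arguments positive): `exp ψ ≤ C`. [this work] -/
theorem exp_psi_le {P p q Q Ia Ib C : ℝ} (hC : 0 < C)
    (h : P * log Q ≤ p * log Ia + q * log Ib + log C) :
    exp (P * log Q - p * log Ia - q * log Ib) ≤ C := by
  calc exp (P * log Q - p * log Ia - q * log Ib) ≤ exp (log C) := exp_le_exp.2 (by linarith)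
    _ = C := exp_log hC

/-- **The law along one pair weight (strict case).**  If all four coordinates are positive at both endpoints, the logarithmic law
`(p+q) log Q ≤ p log I_a + q log I_b + log I_c` holds at `r = 0` and `r = 1`, and `XS` holds on `[0,1]`, then the logarithmic law holds at
every `r ∈ [0,1]`. [this work] -/
theorem asym_onePair {p q q₀ dq a₀ da b₀ db c₀ dc r : ℝ} (hp : 1 ≤ p) (hq : 1 ≤ q)
    (hpq : p ^ 2 + p * q + q ^ 2 ≤ p * q * (p + q))
    (hq0 : 0 < q₀) (hq1 : 0 < q₀ - dq) (ha0 : 0 < a₀) (ha1 : 0 < a₀ - da)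
    (hb0 : 0 < b₀) (hb1 : 0 < b₀ - db) (hc0 : 0 < c₀) (hc1 : 0 < c₀ - dc) (hda : 0 ≤ da) (hdb : 0 ≤ db)
    (hXS : ∀ r ∈ Icc (0 : ℝ) 1, (q₀ - r * dq) * (da * (b₀ - r * db) + db * (a₀ - r * da)) ≤ dq * (a₀ - r * da) * (b₀ - r * db))
    (h0 : (p + q) * log q₀ ≤ p * log a₀ + q * log b₀ + log c₀)
    (h1 : (p + q) * log (q₀ - dq) ≤ p * log (a₀ - da) + q * log (b₀ - db) + log (c₀ - dc))
    (hr0 : 0 ≤ r) (hr1 : r ≤ 1) :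
    (p + q) * log (q₀ - r * dq) ≤ p * log (a₀ - r * da) + q * log (b₀ - r * db) + log (c₀ - r * dc) := by
  -- positivity along the segment
  have affine_pos : ∀ {x0 x1 : ℝ}, 0 < x0 → 0 < x1 → 0 < (1 - r) * x0 + r * x1 := by
    intro x0 x1 h0 h1
    rcases le_or_gt r (1 / 2) with h | h
    · have : 0 ≤ r * x1 := mul_nonneg hr0 h1.le
      nlinarith
    · have : 0 ≤ (1 - r) * x0 := mul_nonneg (sub_nonneg.2 hr1) h0.le
      nlinarith
  have pC : 0 < c₀ - r * dc := by
    have : c₀ - r * dc = (1 - r) * c₀ + r * (c₀ - dc) := by ring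
    rw [this]; exact affine_pos hc0 hc1
  have pQ : 0 < q₀ - r * dq := by
    have : q₀ - r * dq = (1 - r) * q₀ + r * (q₀ - dq) := by ring
    rw [this]; exact affine_pos hq0 hq1
  have pA : 0 < a₀ - r * da := by
    have : a₀ - r * da = (1 - r) * a₀ + r * (a₀ - da) := by ring
    rw [this]; exact affine_pos ha0 ha1
  have pB : 0 < b₀ - r * db := by
    have : b₀ - r * db = (1 - r) * b₀ + r * (b₀ - db) := by ring
    rw [this]; exact affine_pos hb0 hb1
  -- `exp ψ(0) ≤ c₀`, `exp ψ(1) ≤ c₀ − dc`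
  have hF0 : exp ((p + q) * log (q₀ - 0 * dq) - p * log (a₀ - 0 * da) - q * log (b₀ - 0 * db)) ≤ c₀ := by
    refine exp_psi_le hc0 ?_
    simpa using h0
  have hF1 : exp ((p + q) * log (q₀ - 1 * dq) - p * log (a₀ - 1 * da) - q * log (b₀ - 1 * db)) ≤ c₀ - dc := by
    refine exp_psi_le hc1 ?_
    simpa using h1
  -- chord
  have hc := (convexOn_asym hp hq hpq hq0 hq1 ha0 ha1 hb0 hb1 hda hdb hXS).2 (left_mem_Icc.2 zero_le_one)
    (right_mem_Icc.2 zero_le_one) (sub_nonneg.2 hr1) hr0 (sub_add_cancel 1 r)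
  simp only [smul_eq_mul, mul_zero, mul_one, zero_add] at hc
  have hFr : exp ((p + q) * log (q₀ - r * dq) - p * log (a₀ - r * da) - q * log (b₀ - r * db)) ≤ c₀ - r * dc := by
    have h1r : 0 ≤ 1 - r := sub_nonneg.2 hr1
    calc exp ((p + q) * log (q₀ - r * dq) - p * log (a₀ - r * da) - q * log (b₀ - r * db))
        ≤ (1 - r) * exp ((p + q) * log (q₀ - 0 * dq) - p * log (a₀ - 0 * da) - q * log (b₀ - 0 * db)) +
            r * exp ((p + q) * log (q₀ - 1 * dq) - p * log (a₀ - 1 * da) - q * log (b₀ - 1 * db)) := hc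
      _ ≤ (1 - r) * c₀ + r * (c₀ - dc) := add_le_add (mul_le_mul_of_nonneg_left hF0 h1r) (mul_le_mul_of_nonneg_left hF1 hr0)
      _ = c₀ - r * dc := by ring
  -- take logarithms
  have hlog := log_le_log (exp_pos _) hFr
  rw [log_exp] at hlog
  linarith

/-- **The law along one pair weight, endpoint form without positivity hypotheses (logarithmic form).**
Data: `Q, I_a, I_b, I_c` at `r = 0` (`q₀, a₀, b₀, c₀`) and at `r = 1` (`q₁, a₁, b₁, c₁`), all nonnegative, with the order relations
`Q ≤ I_a, I_b, I_c` at both ends, the decrements `q₀ − q₁ = dq_a + dq_b ≥ 0`, `a₁ ≤ a₀`, `b₁ ≤ b₀`, the termwise inequalities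
`(a₀ − a₁)·q₀ ≤ dq_a·a₀`, `(b₀ − b₁)·q₀ ≤ dq_b·b₀`, and the law `Q = 0 ∨ (p+q) log Q ≤ p log I_a + q log I_b + log I_c` at both ends.
Conclusion: the law at `(1−r)·(end 0) + r·(end 1)` for every `r ∈ [0,1]`. [this work] -/
theorem asym_onePair_log {p q q₀ q₁ a₀ a₁ b₀ b₁ c₀ c₁ dqa dqb r : ℝ} (hp : 1 ≤ p) (hq : 1 ≤ q)
    (hpq : p ^ 2 + p * q + q ^ 2 ≤ p * q * (p + q))
    (hq1 : 0 ≤ q₁) (hdqa : 0 ≤ dqa) (hdqb : 0 ≤ dqb) (hdq : q₀ - q₁ = dqa + dqb)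
    (ha : a₁ ≤ a₀) (hb : b₁ ≤ b₀) (hc1 : 0 ≤ c₁)
    (hqa0 : q₀ ≤ a₀) (hqb0 : q₀ ≤ b₀) (hqc0 : q₀ ≤ c₀) (hqa1 : q₁ ≤ a₁) (hqb1 : q₁ ≤ b₁) (hqc1 : q₁ ≤ c₁)
    (ta : (a₀ - a₁) * q₀ ≤ dqa * a₀) (tb : (b₀ - b₁) * q₀ ≤ dqb * b₀)
    (h0 : q₀ = 0 ∨ (p + q) * log q₀ ≤ p * log a₀ + q * log b₀ + log c₀)
    (h1 : q₁ = 0 ∨ (p + q) * log q₁ ≤ p * log a₁ + q * log b₁ + log c₁)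
    (hr0 : 0 ≤ r) (hr1 : r ≤ 1) :
    (1 - r) * q₀ + r * q₁ = 0 ∨
      (p + q) * log ((1 - r) * q₀ + r * q₁) ≤ p * log ((1 - r) * a₀ + r * a₁) + q * log ((1 - r) * b₀ + r * b₁)
        + log ((1 - r) * c₀ + r * c₁) := by
  have h1r : 0 ≤ 1 - r := sub_nonneg.2 hr1
  have hq0 : 0 ≤ q₀ := by linarith
  by_cases hQr : (1 - r) * q₀ + r * q₁ = 0
  · exact Or.inl hQr
  right
  have hQr_pos : 0 < (1 - r) * q₀ + r * q₁ :=
    lt_of_le_of_ne (add_nonneg (mul_nonneg h1r hq0) (mul_nonneg hr0 hq1)) (Ne.symm hQr)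
  -- `q₀ > 0`
  have hq0p : 0 < q₀ := by
    by_contra h
    have hz0 : q₀ = 0 := le_antisymm (not_lt.1 h) hq0
    have hz1 : q₁ = 0 := by linarith
    rw [hz0, hz1] at hQr_pos
    simp at hQr_pos
  have ha0p : 0 < a₀ := lt_of_lt_of_le hq0p hqa0
  have hb0p : 0 < b₀ := lt_of_lt_of_le hq0p hqb0
  have hc0p : 0 < c₀ := lt_of_lt_of_le hq0p hqc0
  have h0' : (p + q) * log q₀ ≤ p * log a₀ + q * log b₀ + log c₀ := h0.resolve_left hq0p.ne'
  obtain ⟨hp1, hq1'⟩ := one_lt_of_admissible hp hq hpq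
  rcases hq1.eq_or_lt with hq1z | hq1p
  · -- degenerate endpoint `q₁ = 0 < q₀`; then `r < 1`
    have hr1' : r < 1 := by
      by_contra h
      have : r = 1 := le_antisymm hr1 (not_lt.1 h)
      rw [this, ← hq1z] at hQr_pos
      simp at hQr_pos
    have h1r' : 0 < 1 - r := sub_pos.2 hr1'
    have hdq' : q₀ = dqa + dqb := by linarith
    -- lower bounds for the three coordinates at `r`
    have hα : (1 - r) * q₀ ≤ q₀ - r * dqa := by
      have e : q₀ - r * dqa - (1 - r) * q₀ = r * dqb := by rw [hdq']; ring
      nlinarith [mul_nonneg hr0 hdqb]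
    have hβ : (1 - r) * q₀ ≤ q₀ - r * dqb := by
      have e : q₀ - r * dqb - (1 - r) * q₀ = r * dqa := by rw [hdq']; ring
      nlinarith [mul_nonneg hr0 hdqa]
    have hαp : 0 < q₀ - r * dqa := lt_of_lt_of_le (mul_pos h1r' hq0p) hα
    have hβp : 0 < q₀ - r * dqb := lt_of_lt_of_le (mul_pos h1r' hq0p) hβ
    have hαβ : (1 - r) * q₀ ^ 2 ≤ (q₀ - r * dqa) * (q₀ - r * dqb) := by
      have e : (q₀ - r * dqa) * (q₀ - r * dqb) - (1 - r) * q₀ ^ 2 =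
          r * q₀ * (q₀ - (dqa + dqb)) + r ^ 2 * (dqa * dqb) := by ring
      have : r * q₀ * (q₀ - (dqa + dqb)) = 0 := by rw [← hdq', sub_self, mul_zero]
      nlinarith [mul_nonneg (sq_nonneg r) (mul_nonneg hdqa hdqb)]
    have hA : a₀ * (q₀ - r * dqa) ≤ q₀ * ((1 - r) * a₀ + r * a₁) := by
      have e : q₀ * ((1 - r) * a₀ + r * a₁) - a₀ * (q₀ - r * dqa) = r * (dqa * a₀ - (a₀ - a₁) * q₀) := by ring
      have := mul_nonneg hr0 (sub_nonneg.2 ta)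
      linarith
    have hB : b₀ * (q₀ - r * dqb) ≤ q₀ * ((1 - r) * b₀ + r * b₁) := by
      have e : q₀ * ((1 - r) * b₀ + r * b₁) - b₀ * (q₀ - r * dqb) = r * (dqb * b₀ - (b₀ - b₁) * q₀) := by ring
      have := mul_nonneg hr0 (sub_nonneg.2 tb)
      linarith
    have hC : (1 - r) * c₀ ≤ (1 - r) * c₀ + r * c₁ := by nlinarith
    have hAr : 0 < (1 - r) * a₀ + r * a₁ :=
      (mul_pos_iff_of_pos_left hq0p).mp (lt_of_lt_of_le (mul_pos ha0p hαp) hA)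
    have hBr : 0 < (1 - r) * b₀ + r * b₁ :=
      (mul_pos_iff_of_pos_left hq0p).mp (lt_of_lt_of_le (mul_pos hb0p hβp) hB)
    have hCr : 0 < (1 - r) * c₀ + r * c₁ := lt_of_lt_of_le (mul_pos h1r' hc0p) hC
    -- logarithms of the atomic inequalities
    have lA : log a₀ + log (q₀ - r * dqa) ≤ log q₀ + log ((1 - r) * a₀ + r * a₁) := by
      rw [← log_mul ha0p.ne' hαp.ne', ← log_mul hq0p.ne' hAr.ne']
      exact log_le_log (mul_pos ha0p hαp) hA
    have lB : log b₀ + log (q₀ - r * dqb) ≤ log q₀ + log ((1 - r) * b₀ + r * b₁) := by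
      rw [← log_mul hb0p.ne' hβp.ne', ← log_mul hq0p.ne' hBr.ne']
      exact log_le_log (mul_pos hb0p hβp) hB
    have lC : log (1 - r) + log c₀ ≤ log ((1 - r) * c₀ + r * c₁) := by
      rw [← log_mul h1r'.ne' hc0p.ne']
      exact log_le_log (mul_pos h1r' hc0p) hC
    have lα : log (1 - r) + log q₀ ≤ log (q₀ - r * dqa) := by
      rw [← log_mul h1r'.ne' hq0p.ne']
      exact log_le_log (mul_pos h1r' hq0p) hα
    have lβ : log (1 - r) + log q₀ ≤ log (q₀ - r * dqb) := by
      rw [← log_mul h1r'.ne' hq0p.ne']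
      exact log_le_log (mul_pos h1r' hq0p) hβ
    have lαβ : log (1 - r) + 2 * log q₀ ≤ log (q₀ - r * dqa) + log (q₀ - r * dqb) := by
      have h := log_le_log (mul_pos h1r' (pow_pos hq0p 2)) hαβ
      rw [log_mul h1r'.ne' (pow_pos hq0p 2).ne', log_pow, log_mul hαp.ne' hβp.ne'] at h
      simpa using h
    have lQ : log ((1 - r) * q₀ + r * q₁) = log (1 - r) + log q₀ := by
      rw [← hq1z, mul_zero, add_zero, log_mul h1r'.ne' hq0p.ne']
    rw [lQ]
    -- combine: `p log α + q log β ≥ (log α + log β) + (p−1) log α + (q−1) log β`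
    have hp1' : 0 ≤ p - 1 := by linarith
    have hq1'' : 0 ≤ q - 1 := by linarith
    have cα := mul_le_mul_of_nonneg_left lα hp1'
    have cβ := mul_le_mul_of_nonneg_left lβ hq1''
    have cA := mul_le_mul_of_nonneg_left lA (by linarith : (0 : ℝ) ≤ p)
    have cB := mul_le_mul_of_nonneg_left lB (by linarith : (0 : ℝ) ≤ q)
    linarith [cα, cβ, cA, cB, lC, lαβ, h0']
  · -- main case: `q₁ > 0`, all coordinates positive at both ends
    have ha1p : 0 < a₁ := lt_of_lt_of_le hq1p hqa1
    have hb1p : 0 < b₁ := lt_of_lt_of_le hq1p hqb1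
    have hc1p : 0 < c₁ := lt_of_lt_of_le hq1p hqc1
    have h1' : (p + q) * log q₁ ≤ p * log a₁ + q * log b₁ + log c₁ := h1.resolve_left hq1p.ne'
    have eq1 : q₀ - (dqa + dqb) = q₁ := by linarith
    have hXS : ∀ r' ∈ Icc (0 : ℝ) 1, (q₀ - r' * (dqa + dqb)) * ((a₀ - a₁) * (b₀ - r' * (b₀ - b₁)) +
        (b₀ - b₁) * (a₀ - r' * (a₀ - a₁))) ≤ (dqa + dqb) * (a₀ - r' * (a₀ - a₁)) * (b₀ - r' * (b₀ - b₁)) := by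
      intro r' hr'
      have pa : 0 ≤ a₀ - r' * (a₀ - a₁) := by
        have e : a₀ - r' * (a₀ - a₁) = (1 - r') * a₀ + r' * a₁ := by ring
        rw [e]; exact add_nonneg (mul_nonneg (sub_nonneg.2 hr'.2) ha0p.le) (mul_nonneg hr'.1 ha1p.le)
      have pb : 0 ≤ b₀ - r' * (b₀ - b₁) := by
        have e : b₀ - r' * (b₀ - b₁) = (1 - r') * b₀ + r' * b₁ := by ring
        rw [e]; exact add_nonneg (mul_nonneg (sub_nonneg.2 hr'.2) hb0p.le) (mul_nonneg hr'.1 hb1p.le)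
      have ta' : (a₀ - a₁) * q₀ ≤ dqa * a₀ := ta
      have tb' : (b₀ - b₁) * q₀ ≤ dqb * b₀ := tb
      refine xs_of_termwise hr'.1 hr'.2 pa pb (by linarith) ?_ (by linarith) ?_
      · exact termwise_one_of_zero (sub_nonneg.2 ha) hdqb (by linarith)
      · have h := termwise_one_of_zero (sub_nonneg.2 hb) hdqa (by linarith : (b₀ - b₁) * q₀ ≤ dqb * b₀)
        have e : dqb + dqa = dqa + dqb := add_comm _ _
        rw [e] at h; exact h
    have key := asym_onePair (p := p) (q := q) (q₀ := q₀) (dq := dqa + dqb) (a₀ := a₀) (da := a₀ - a₁) (b₀ := b₀)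
      (db := b₀ - b₁) (c₀ := c₀) (dc := c₀ - c₁) (r := r) hp hq hpq hq0p (by rw [eq1]; exact hq1p) ha0p (by linarith)
      hb0p (by linarith) hc0p (by linarith) (sub_nonneg.2 ha) (sub_nonneg.2 hb) hXS h0'
      (by
        have ea : a₀ - (a₀ - a₁) = a₁ := by ring
        have eb : b₀ - (b₀ - b₁) = b₁ := by ring
        have ec : c₀ - (c₀ - c₁) = c₁ := by ring
        rw [eq1, ea, eb, ec]; exact h1') hr0 hr1
    have e1 : (1 - r) * q₀ + r * q₁ = q₀ - r * (dqa + dqb) := by linear_combination (-r) * hdq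
    have e2 : (1 - r) * a₀ + r * a₁ = a₀ - r * (a₀ - a₁) := by ring
    have e3 : (1 - r) * b₀ + r * b₁ = b₀ - r * (b₀ - b₁) := by ring
    have e4 : (1 - r) * c₀ + r * c₁ = c₀ - r * (c₀ - c₁) := by ring
    rw [e1, e2, e3, e4]
    exact key

end Summit.CriticalPhenomena.PercolationContinuityZ3.Theorems.ThreePointIsoAsymOnePair
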